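import Summits.BirchSwinnertonDyer.BirchSwinnertonDyer.Theorems.ByReductionTypeAtTwoMultKatoRatOfInputs
import Summits.BirchSwinnertonDyer.BirchSwinnertonDyer.Theorems.PrintX9KatoZetaImageLocalized
import Summits.BirchSwinnertonDyer.Rank1Residual.X11b.MultiplicativeDivisibility
import Literature.NumberTheory.EllipticCurves.Kato2004.DivisibilityInputsMultiplicativeFine
import Literature.NumberTheory.EllipticCurves.Kato2004.MainConjectureSkeletonProofs
import Literature.NumberTheory.EllipticCurves.Wuthrich2014.IntegralPAdicLFunctionMultiplicative
import Literature.NumberTheory.EllipticCurves.Rank1Residual.MuLambdaCarriers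
import Literature.NumberTheory.EllipticCurves.SkinnerUrban2014.CharacteristicIdealBaseChangeProofs
import Literature.NumberTheory.EllipticCurves.KatoDivisibilityIntegralSkeletonProofs
import Literature.NumberTheory.EllipticCurves.SelmerInftyTorsionFiniteProofs
import Literature.NumberTheory.EllipticCurves.TateModuleContinuityProofs
import Literature.NumberTheory.EllipticCurves.TateModuleFreeProofs
import HarnessLib

/-!
# Route `PrintX11a`, crux U3 `UpperNonSurjThree` (item stmt-BirchSwinnertonDyer-20613), line «finemu3»: the TRANSFER stub
# `stub_multDivisibilityAt_of_conjA` — Coates–Sujatha (A) at a multiplicative odd prime gives the INTEGRAL cyclotomic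
# divisibility `X11b.MultDivisibilityAt`, modulo the seven displayed Kato/Greenberg/Wuthrich facts

Seat `bsd-line-x11a-p2` (D-0154 KEY (146)/(147)(e); skeleton of record `Cruxes/UpperNonSurjThree/Lines/finemu3.lean`, sha16
`4137ae9383b0650b`; Theses-free module; the same stub text sits in `Cruxes/UpperNonSurjFive/Lines/finemu5.lean`, item 20614 — the theorem is
`p`-generic and serves both). `--supports stmt-BirchSwinnertonDyer-20613`. BSD is not proved by any of this; nothing is
asserted about any curve; every theorem is CONDITIONAL on its displayed hypotheses (seven named facts, three of them Kato
CONSTRUCTION facts — flags `Kato-17.11-at-{nonsplit,split}-mult`, `Kato-p280-image-at-mult`, R-48 ride on THEM, not on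
the theorems — and statement (A) at the pair, the line's OPEN load-bearing stub `stub_conjA_three`, untouched here).

WHAT. §5 `Theorems.stub_multDivisibilityAt_of_conjA` has the registered signature VERBATIM (seven facts
in the stub's order → `∀ W p, p ≠ 2 → Mult W p → Irr W p → ConjAAt W p → MultDivisibilityAt W p`); it wraps §4
`X11b.multDivisibilityAt_of_katoFacts_of_conjAAt`, the (A)-variant of `X11b.multDivisibilityAt_of_katoFacts_of_muAn` and the
multiplicative copy of the LANDED good-ordinary `SmallImageMu.katoDivisibilityAt_of_conjAAt_F1`: the analytic `μ = 0`
certificate is replaced by (A), and NO `μ(X) = 0` is produced — the `(p)`-part of the divisibility is read off Kato's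
§17.13 sequence `P → X → X₀ → 0` with the `Λ/(G)` term KEPT (REF-AUDIT §Q (i): not the μ-road port
`MultMu.lengthAt_X_le_of_mult`, which assumes `G ∉ 𝔭`; XI's exact fine quotient, no `×p^a` fields).

PROOF (Kato Thm. 17.4 (3), p. 280, input at `(p)` replaced). Data: cyclotomic `(κ, γ)`, newform `f`, Selmer dual datum
`D` (`X = D.X`, torsion + `g ∈ char_Λ X` with `ι g = pⁿ·L` resp. `ι(T·g) = pⁿ·L` — Kato `⊗ℚ`, tree
`MultKatoRat.katoMultiplicativeDivisibilityRat_of_facts_odd`), `ϖ ≠ 0`, the MTT function `L`, `G ∈ Λ` with `ι G = ϖ·L`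
(Wuthrich Cor. 18). In `Λ`: `C(ϖ.num)·g = C(ϖ.den·pⁿ)·H` with `H = G` (non-split) resp. `G = T·H` (split; `T` prime to
constants). CLAIM `H ∈ char_Λ X` ⟸ (`Module.mem_charIdeal_of_lengthAt_le`) `ℓ_𝔭(X) ≤ ℓ_𝔭(Λ/(H))` at every height-one `𝔭`:
`𝔭 ∌ p` — `ℓ_𝔭(X) ≤ ℓ_𝔭(Λ/(g)) = ℓ_𝔭(Λ/(C(num)·g)) = ℓ_𝔭(Λ/(C(den·pⁿ)·H)) = ℓ_𝔭(Λ/(H))` (Skinner–Urban §3.1.6; non-zero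
constants are units at `𝔭`); `𝔭 = (p)` — the fine package (`toX∘loc = 0`, `π : X ↠ X₀` exact after `P → X`, p. 280 image
clause `s·G ∈ col(loc Z)`, `s ∉ 𝔭`) gives `ℓ_𝔭(X) ≤ ℓ_𝔭(P/loc Z) + ℓ_𝔭(X₀) ≤ ℓ_𝔭(Λ/(G)) + ℓ_𝔭(X₀)` (§2), (A) ⟹ `μ(X₀) = 0`
(`ConjAAt.fineMuZeroAt`) ⟹ `ℓ_(p)(X₀) = 0` (`X₀` a quotient of the torsion `X`), and `ℓ_(p)(Λ/(T·H)) = ℓ_(p)(Λ/(H))`.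
No image hypothesis beyond `Irr(E[p])` (used only for the image clause), no (ram), no surjectivity, no BCS.

HONEST FRAMING. Theorems only (no `def`, no named fact minted, no `sorry`, no instance/notation); item 20613 does NOT
close (the crux still needs `stub_conjA_three` + `stub_pubFactsAn`); PARTITION 0. Beyond-print theorem: Kato's integral
divisibility at `p ∥ N` WITHOUT (12.5.4)'s image hypothesis, modulo (A) and the displayed construction facts.

References: [Kato2004Asterisque] Thm. 12.4–12.6 (pp. 221–222), (14.9.3) (p. 240), Thm. 17.4 (p. 273), Prop. 17.11
(p. 277), §17.13 (pp. 279–280); [CoatesSujatha2005] §3 statement (A), Thm. 3.4; [Wuthrich2014] p. 391, Cor. 18 (p. 398);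
[Kobayashi2006DocMath] Thm. 4.1; [GreenbergLNM1716] Thm. 1.5; [SkinnerUrban2014] §3.1.6; [Washington1997] §13.2; tree
`Theorems/ErratumRoadFiveNonSurjCorner{MuTransferMult,TwinKatoRat,BranchesAn}.lean`, `SmallImageMu/MuDefectLeFineMu{,Edges}.lean`,
`Kato2004/DivisibilityInputsMultiplicative{,Fine}.lean`, `KatoDivisibilityIntegralSkeletonProofs.lean`, `Rank1Residual/MuLambdaCarriers.lean`.
-/

set_option autoImplicit false
set_option linter.dupNamespace false

noncomputable section

open scoped Classical NumberField MatrixGroups ModularForm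

open CongruenceSubgroup WeierstrassCurve Field IsDedekindDomain Literature.NumberTheory.GaloisRepresentations
  Literature.NumberTheory.EllipticCurves Literature.NumberTheory.EllipticCurves.ModularForms
  Literature.NumberTheory.EllipticCurves.Kato2004 Literature.NumberTheory.EllipticCurves.Rank1Residual
  Literature.NumberTheory.EllipticCurves.Rank1Residual.Typed Literature.NumberTheory.EllipticCurves.Wuthrich2014
  Literature.NumberTheory.EllipticCurves.Greenberg1999 Summit.BirchSwinnertonDyer.Rank1Residual
  Summit.BirchSwinnertonDyer.Rank1Residual.X5.O1 Summit.BirchSwinnertonDyer.BirchSwinnertonDyer.Rank1Residual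

namespace Summit.BirchSwinnertonDyer.Rank1Residual.X11b.MultFineMu

open Module IwasawaAlgebra

/-! ### §1 Algebra over `Λ = ℤ_p⟦T⟧` -/

section Algebra
variable {p : ℕ} [Fact p.Prime]

/-- `ℓ_𝔭(Λ/(s·x)) = ℓ_𝔭(Λ/(x))` when `s ∉ 𝔭` (additivity of local lengths of cyclic quotients in a domain and
`(Λ/(s))_𝔭 = 0`). [cite: Washington1997, §13.2] -/
theorem lengthAt_quotient_span_mul_eq_of_not_mem {R : Type*} [CommRing R] [IsDomain R] {s : R} (x : R)
    (𝔭 : PrimeSpectrum R) (hs : s ∉ 𝔭.asIdeal) :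
    lengthAt R (R ⧸ Ideal.span {s * x}) 𝔭 = lengthAt R (R ⧸ Ideal.span {x}) 𝔭 := by
  have hs0 : s ≠ 0 := by rintro rfl; exact hs (zero_mem _)
  rw [lengthAt_quotient_span_singleton_mul x hs0 𝔭,
    lengthAt_quotient_eq_zero_of_not_le (I := Ideal.span {s}) (by rwa [Ideal.span_singleton_le_iff_mem]),
    zero_add]

/-- `Λ/(a)` is a torsion `Λ`-module for `a ≠ 0` (domain). [folklore] -/
theorem isTorsion_quotient_span_singleton {R : Type*} [CommRing R] [IsDomain R] {a : R} (ha : a ≠ 0) :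
    Module.IsTorsion R (R ⧸ Ideal.span {a}) := by
  intro x
  refine ⟨⟨a, mem_nonZeroDivisors_of_ne_zero ha⟩, ?_⟩
  obtain ⟨y, rfl⟩ := Ideal.Quotient.mk_surjective x
  change a • Ideal.Quotient.mk (Ideal.span {a}) y = 0
  rw [← Ideal.Quotient.mk_eq_mk, ← Submodule.Quotient.mk_smul, Submodule.Quotient.mk_eq_zero, smul_eq_mul]
  exact Ideal.mul_mem_right _ _ (Ideal.mem_span_singleton_self a)

/-- A non-zero constant `C x` (`x ∈ ℤ_p`) lies in no height-one prime `𝔭 ∌ p` of `Λ`: `x = u·p^k` with `u` a unit.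
[cite: Washington1997, §13.2] -/
theorem C_not_mem_of_C_p_not_mem {x : ℤ_[p]} (hx : x ≠ 0) (𝔭 : PrimeSpectrum (IwasawaAlgebra p))
    (hp𝔭 : PowerSeries.C (p : ℤ_[p]) ∉ 𝔭.asIdeal) : PowerSeries.C x ∉ 𝔭.asIdeal := by
  intro hx𝔭
  rw [PadicInt.unitCoeff_spec hx, map_mul, map_pow] at hx𝔭
  rcases 𝔭.isPrime.mem_or_mem hx𝔭 with h | h
  · exact 𝔭.isPrime.ne_top (Ideal.eq_top_of_isUnit_mem _ h ((Units.isUnit _).map _))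
  · exact hp𝔭 (𝔭.isPrime.mem_of_pow_mem _ h)

/-- **Period-ratio bookkeeping in `Λ`.** If `ι x = C(pⁿ)·L` and `ι G = C(ϖ)·L` (`ϖ ∈ ℚ`), then
`C(ϖ.num)·x = C(ϖ.den·pⁿ)·G` in `Λ` (`ι` is injective and `ϖ.den·ϖ = ϖ.num`). [cite: GreenbergVatsal2000, p. 2, (1)–(2)] -/
theorem C_num_mul_eq_C_den_mul {n : ℕ} {x G : IwasawaAlgebra p} {ϖ : ℚ} {L : PowerSeries ℚ_[p]}
    (hι : iwasawaToPowerSeries p x = PowerSeries.C ((p : ℚ_[p]) ^ n) * L)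
    (hG : iwasawaToPowerSeries p G = PowerSeries.C ((ϖ : ℚ) : ℚ_[p]) * L) :
    PowerSeries.C ((ϖ.num : ℤ) : ℤ_[p]) * x =
      PowerSeries.C (((ϖ.den : ℕ) : ℤ_[p]) * (p : ℤ_[p]) ^ n) * G := by
  apply iwasawaToPowerSeries_injective p
  have hcast : ((ϖ.num : ℤ) : ℚ_[p]) = ((ϖ.den : ℕ) : ℚ_[p]) * ((ϖ : ℚ) : ℚ_[p]) := by
    have h := congrArg (fun q : ℚ ↦ (q : ℚ_[p])) (Rat.den_mul_eq_num ϖ)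
    push_cast at h
    exact h.symm
  rw [map_mul, map_mul, hι, hG, PowerSeries.map_C, PowerSeries.map_C, ← mul_assoc, ← mul_assoc, ← map_mul,
    ← map_mul]
  congr 2
  rw [map_intCast, map_mul, map_pow, map_natCast, map_natCast, hcast]
  ring

end Algebra

/-! ### §2 The chart inequality over a multiplicative §17.13 package, `Λ/(G₁)` term kept -/

section Chart

variable {p : ℕ} [Fact p.Prime] {W : WeierstrassCurve ℚ} [W.IsElliptic]
  [ContinuousSMul ℤ_[p] (W.tateModule p)] {L : PowerSeries ℚ_[p]}
  {κ : ZpExtension ℚ p} {γ : absoluteGaloisGroup ℚ}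
  {I : IwasawaH1Data W p κ γ} {D : W.SelmerDualData κ γ}

/-- **(14.9.3)/(17.13.1) bookkeeping at a height-one prime `𝔭`, general form**: for a multiplicative package with
`toX ∘ loc = 0`, `π : X → Y` exact after `P → X`, and `s·G₁ ∈ col(loc Z)` for some `s ∉ 𝔭`:
`ℓ_𝔭(X) ≤ ℓ_𝔭(Λ/(G₁)) + ℓ_𝔭(Y)` — `X/toX(P) ↪ Y`, `toX` factors through `P/loc Z ↪ Λ/col(loc Z) ↞ Λ/(s·G₁)`,
and `ℓ_𝔭(Λ/(s·G₁)) = ℓ_𝔭(Λ/(G₁))`.  (`MultMu.lengthAt_X_le_of_mult` is the case `G₁ ∉ 𝔭`.)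
[cite: Kato2004Asterisque, (14.9.3) (p. 240), Prop. 17.11 (p. 277) and §17.13 (pp. 279–280)] -/
theorem lengthAt_X_le_add_of_mult (K : MultDivisibilityInputs W p L κ γ I D)
    (hloc0 : ∀ h : I.H, K.toX (K.loc h) = 0) {G₁ : IwasawaAlgebra p}
    (𝔭 : PrimeSpectrum (IwasawaAlgebra p))
    (himg : ∃ s : IwasawaAlgebra p, s ∉ 𝔭.asIdeal ∧ s * G₁ ∈ Submodule.map (K.col ∘ₗ K.loc) K.Z)
    {Y : Type*} [AddCommGroup Y] [Module (IwasawaAlgebra p) Y]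
    (π : D.X →ₗ[IwasawaAlgebra p] Y) (hπ : Function.Exact K.toX π) :
    lengthAt (IwasawaAlgebra p) D.X 𝔭 ≤
      lengthAt (IwasawaAlgebra p) (IwasawaAlgebra p ⧸ Ideal.span {G₁}) 𝔭 +
        lengthAt (IwasawaAlgebra p) Y 𝔭 := by
  obtain ⟨s, hs, hsG⟩ := himg
  set LZ : Submodule (IwasawaAlgebra p) K.P := Submodule.map K.loc K.Z with hLZ
  set M : Ideal (IwasawaAlgebra p) := Submodule.map K.col LZ with hM
  have hM_eq : Submodule.map (K.col ∘ₗ K.loc) K.Z = M := by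
    rw [hM, hLZ, Submodule.map_comp]
  have hsGM : s * G₁ ∈ M := hM_eq ▸ hsG
  -- `ℓ(Λ/M) ≤ ℓ(Λ/(s·G₁)) = ℓ(Λ/(G₁))`
  have hΛM : lengthAt (IwasawaAlgebra p) (IwasawaAlgebra p ⧸ M) 𝔭 ≤
      lengthAt (IwasawaAlgebra p) (IwasawaAlgebra p ⧸ Ideal.span {G₁}) 𝔭 := by
    have hle : Ideal.span {s * G₁} ≤ M := by rwa [Ideal.span_singleton_le_iff_mem]
    have hψ : Function.Surjective (Submodule.factor hle) := by
      intro y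
      obtain ⟨x, rfl⟩ := Submodule.Quotient.mk_surjective _ y
      exact ⟨Submodule.Quotient.mk x, rfl⟩
    calc lengthAt (IwasawaAlgebra p) (IwasawaAlgebra p ⧸ M) 𝔭
        ≤ lengthAt (IwasawaAlgebra p) (IwasawaAlgebra p ⧸ Ideal.span {s * G₁}) 𝔭 :=
          lengthAt_le_of_surjective (Submodule.factor hle) hψ 𝔭
      _ = lengthAt (IwasawaAlgebra p) (IwasawaAlgebra p ⧸ Ideal.span {G₁}) 𝔭 :=
          lengthAt_quotient_span_mul_eq_of_not_mem G₁ 𝔭 hs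
  -- `P/loc Z ↪ Λ/M` by `col`
  have hPLZ : lengthAt (IwasawaAlgebra p) (K.P ⧸ LZ) 𝔭 ≤
      lengthAt (IwasawaAlgebra p) (IwasawaAlgebra p ⧸ Ideal.span {G₁}) 𝔭 := by
    refine le_trans (lengthAt_le_of_injective (Submodule.mapQ LZ M K.col fun y hy ↦ ⟨y, hy, rfl⟩) ?_ 𝔭) hΛM
    rw [← LinearMap.ker_eq_bot, Submodule.ker_mapQ, hM,
      Submodule.comap_map_eq_of_injective K.col_injective, Submodule.mkQ_map_self]
  -- `toX` factors through `P/loc Z`, and `P/loc Z → X → Y` is exact at `X`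
  have hle : LZ ≤ LinearMap.ker K.toX := by rintro _ ⟨z, -, rfl⟩; exact hloc0 z
  let f' : (K.P ⧸ LZ) →ₗ[IwasawaAlgebra p] D.X := LZ.liftQ K.toX hle
  have hf' : Function.Exact f' π := by
    rw [LinearMap.exact_iff, Submodule.range_liftQ]
    exact LinearMap.exact_iff.mp hπ
  calc lengthAt (IwasawaAlgebra p) D.X 𝔭
      ≤ lengthAt (IwasawaAlgebra p) (K.P ⧸ LZ) 𝔭 + lengthAt (IwasawaAlgebra p) Y 𝔭 :=
        lengthAt_le_add_of_exact f' π hf' 𝔭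
    _ ≤ lengthAt (IwasawaAlgebra p) (IwasawaAlgebra p ⧸ Ideal.span {G₁}) 𝔭 +
        lengthAt (IwasawaAlgebra p) Y 𝔭 := add_le_add hPLZ le_rfl

end Chart

/-! ### §3 The two height-one bounds and the core: `H ∈ char_Λ X` -/

section Core
variable {p : ℕ} [Fact p.Prime]

/-- **Off `(p)`: the rational divisibility bounds `ℓ_𝔭(X)`.** If `X` is a finitely generated torsion `Λ`-module,
`g ∈ char_Λ X`, and `C(a)·g = C(b)·H` with non-zero constants `a, b ∈ ℤ_p` and `H ≠ 0`, then
`ℓ_𝔭(X) ≤ ℓ_𝔭(Λ/(H))` at every height-one `𝔭 ∌ p` (`ℓ_𝔭(X) ≤ ℓ_𝔭(Λ/(g))` by Skinner–Urban §3.1.6, and the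
constants are units at `𝔭`). [cite: SkinnerUrban2014, §3.1.6 (p. 20)] [cite: Washington1997, §13.2] -/
theorem lengthAt_le_of_mem_charIdeal_of_C_mul_eq {X : Type*} [AddCommGroup X] [Module (IwasawaAlgebra p) X]
    [Module.Finite (IwasawaAlgebra p) X] (hX : Module.IsTorsion (IwasawaAlgebra p) X)
    {g H : IwasawaAlgebra p} {a b : ℤ_[p]} (ha : a ≠ 0) (hb : b ≠ 0)
    (hg : g ∈ Module.charIdeal (IwasawaAlgebra p) X)
    (hrel : PowerSeries.C a * g = PowerSeries.C b * H) (hH : H ≠ 0)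
    (𝔭 : PrimeSpectrum (IwasawaAlgebra p)) (h𝔭 : 𝔭.asIdeal.height = 1)
    (hp𝔭 : PowerSeries.C (p : ℤ_[p]) ∉ 𝔭.asIdeal) :
    lengthAt (IwasawaAlgebra p) X 𝔭 ≤ lengthAt (IwasawaAlgebra p) (IwasawaAlgebra p ⧸ Ideal.span {H}) 𝔭 := by
  have hbH : PowerSeries.C b * H ≠ 0 :=
    mul_ne_zero (fun h ↦ hb (PowerSeries.C_injective (by rw [h, map_zero]))) hH
  have hg0 : g ≠ 0 := by
    rintro rfl
    exact hbH (by rw [← hrel, mul_zero])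
  -- `ℓ_𝔭(X) ≤ ℓ_𝔭(Λ/(g))` from `(g) ≤ char X`
  have h1 : lengthAt (IwasawaAlgebra p) X 𝔭 ≤
      lengthAt (IwasawaAlgebra p) (IwasawaAlgebra p ⧸ Ideal.span {g}) 𝔭 := by
    refine SkinnerUrban2014.lengthAt_le_of_charIdeal_le (M := IwasawaAlgebra p ⧸ Ideal.span {g}) (N := X)
      (isTorsion_quotient_span_singleton hg0) hX ?_ 𝔭 h𝔭
    rw [charIdeal_eq_span_of_lengthAt_eq_quotient hg0 fun _ _ ↦ rfl, Ideal.span_singleton_le_iff_mem]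
    exact hg
  rwa [← lengthAt_quotient_span_mul_eq_of_not_mem g 𝔭 (C_not_mem_of_C_p_not_mem ha 𝔭 hp𝔭), hrel,
    lengthAt_quotient_span_mul_eq_of_not_mem H 𝔭 (C_not_mem_of_C_p_not_mem hb 𝔭 hp𝔭)] at h1

variable {W : WeierstrassCurve ℚ} [W.IsElliptic]
  [ContinuousSMul ℤ_[p] (W.tateModule p)] {L : PowerSeries ℚ_[p]}
  {κ : ZpExtension ℚ p} {γ : absoluteGaloisGroup ℚ}
  {I : IwasawaH1Data W p κ γ} {D : W.SelmerDualData κ γ} {Y : W.FineSelmerDualData κ γ}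

/-- **THE CORE of the (A)-transfer at a multiplicative prime.** Data: a multiplicative §17.13 package `K` with
`toX ∘ loc = 0` and a SURJECTIVE fine quotient `π : X ↠ Y.X` exact after `P → X`; `X` f.g. torsion; the p. 280 image
clause for `G` at every height-one prime; `μ(Y.X) = 0` once `Y.X` is f.g. torsion (what `ConjAAt.fineMuZeroAt` delivers);
`G = t·H`, `t ∉ (p)`; the rational divisibility `g ∈ char X`, `C(a)·g = C(b)·H` (`a, b ≠ 0`).  Then `H ∈ char_Λ X`:
at `(p)` by §2 + `ℓ_(p)(X₀) = 0` + `ℓ_(p)(Λ/(t·H)) = ℓ_(p)(Λ/(H))`, off `(p)` by the previous theorem, glued by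
`Module.mem_charIdeal_of_lengthAt_le`.  NO `μ(X) = 0`, no image hypothesis, no BCS.
[cite: Kato2004Asterisque, Thm. 17.4 (3) (p. 273) and §17.13 (pp. 279–280)] [cite: CoatesSujatha2005, §3 statement (A)]
[cite: Washington1997, §13.2] -/
theorem mem_charIdeal_of_multFine_of_fineMuZero (K : MultDivisibilityInputs W p L κ γ I D)
    (hloc0 : ∀ h : I.H, K.toX (K.loc h) = 0)
    (π : D.X →ₗ[IwasawaAlgebra p] Y.X) (hπs : Function.Surjective π) (hπ : Function.Exact K.toX π)
    [Module.Finite (IwasawaAlgebra p) D.X] (hX : D.IsTorsion)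
    (hμY : Module.Finite (IwasawaAlgebra p) Y.X → Module.IsTorsion (IwasawaAlgebra p) Y.X →
      muInvariant p Y.X = 0)
    {G H g t : IwasawaAlgebra p} {a b : ℤ_[p]}
    (himg : ∀ 𝔭 : PrimeSpectrum (IwasawaAlgebra p), 𝔭.asIdeal.height = 1 →
      ∃ s : IwasawaAlgebra p, s ∉ 𝔭.asIdeal ∧ s * G ∈ Submodule.map (K.col ∘ₗ K.loc) K.Z)
    (hGH : G = t * H) (ht : t ∉ augIdealP p)
    (hg : g ∈ D.charIdeal) (ha : a ≠ 0) (hb : b ≠ 0)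
    (hrel : PowerSeries.C a * g = PowerSeries.C b * H) :
    H ∈ D.charIdeal := by
  by_cases hH0 : H = 0
  · subst hH0; exact Submodule.zero_mem _
  haveI : Module.Finite (IwasawaAlgebra p) Y.X := Module.Finite.of_surjective π hπs
  have hYt : Module.IsTorsion (IwasawaAlgebra p) Y.X := by
    intro y
    obtain ⟨x, rfl⟩ := hπs y
    obtain ⟨c, hc⟩ := @hX x
    exact ⟨c, by rw [Submonoid.smul_def, ← map_smul, ← Submonoid.smul_def, hc, map_zero]⟩
  refine Module.mem_charIdeal_of_lengthAt_le hX hH0 fun 𝔭 h𝔭1 ↦ ?_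
  by_cases hp𝔭 : PowerSeries.C (p : ℤ_[p]) ∈ 𝔭.asIdeal
  · -- `𝔭 = (p)`: the fine quotient, statement (A), and the image clause
    have h𝔭 : 𝔭.asIdeal = augIdealP p := ZetaImage.eq_augIdealP_of_height_eq_one_of_C_mem 𝔭 h𝔭1 hp𝔭
    have hY0 : lengthAt (IwasawaAlgebra p) Y.X 𝔭 = 0 := by
      have hfin := lengthAt_ne_top_of_isTorsion p Y.X hYt 𝔭 h𝔭
      have hμ := hμY inferInstance hYt
      rw [muInvariant_eq_toNat_lengthAt p Y.X 𝔭 h𝔭, ENat.toNat_eq_zero] at hμ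
      exact hμ.resolve_right hfin
    have ht𝔭 : t ∉ 𝔭.asIdeal := h𝔭 ▸ ht
    calc lengthAt (IwasawaAlgebra p) D.X 𝔭
        ≤ lengthAt (IwasawaAlgebra p) (IwasawaAlgebra p ⧸ Ideal.span {G}) 𝔭 +
            lengthAt (IwasawaAlgebra p) Y.X 𝔭 :=
          lengthAt_X_le_add_of_mult K hloc0 𝔭 (himg 𝔭 h𝔭1) π hπ
      _ = lengthAt (IwasawaAlgebra p) (IwasawaAlgebra p ⧸ Ideal.span {H}) 𝔭 := by
          rw [hY0, add_zero, hGH, lengthAt_quotient_span_mul_eq_of_not_mem H 𝔭 ht𝔭]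
  · -- `𝔭 ∌ p`: the rational divisibility
    exact lengthAt_le_of_mem_charIdeal_of_C_mul_eq hX ha hb hg hrel hH0 𝔭 h𝔭1 hp𝔭

end Core

end MultFineMu

/-! ### §4 The transfer: `ConjAAt W p ⟹ MultDivisibilityAt W p` at a multiplicative odd prime, `E[p]` irreducible -/

/-- **`X11b.MultDivisibilityAt W p` at an odd multiplicative pair with `E[p]` irreducible, from NAMED facts and
Coates–Sujatha's statement (A) at the pair.** Facts: `hne` Kato (12.2.1), `h12` Thm. 12.4, `hns`/`hsp` the §17.13 inputs
at a non-split ∕ split multiplicative odd prime, `h15` Greenberg 1999 Thm. 1.5, `h18` Wuthrich 2014 Cor. 18, `hfine` the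
§17.13 package with fine quotient and p. 280 image clause (F1-mult); input `hA : ConjAAt W p`.  Kato's `⊗ℚ` divisibility
(`MultKatoRat.katoMultiplicativeDivisibilityRat_of_facts_odd`) gives `g ∈ char X`, `ι g = pⁿ·L` (resp. `ι(T·g) = pⁿ·L`);
Cor. 18 gives `ι G = ϖ·L`; `MultFineMu.mem_charIdeal_of_multFine_of_fineMuZero` puts `G` (resp. `G/T`) in `char X`.
NO `μ(X) = 0`, NO analytic certificate, NO image hypothesis beyond `Irr`, NO (ram).  (A)-variant of
`multDivisibilityAt_of_katoFacts_of_muAn`; multiplicative copy of `SmallImageMu.katoDivisibilityAt_of_conjAAt_F1`.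
[cite: Kato2004Asterisque, Thm. 12.4 (p. 221), (14.9.3) (p. 240), Thm. 17.4 (3) (p. 273), §17.13 (pp. 279–280)]
[cite: CoatesSujatha2005, §3 statement (A) and Thm. 3.4] [cite: Wuthrich2014, p. 391 and Cor. 18 (p. 398)]
[cite: GreenbergLNM1716, Thm. 1.5 (p. 61)] [cite: Kobayashi2006DocMath, Thm. 4.1] -/
theorem multDivisibilityAt_of_katoFacts_of_conjAAt
    (hne : Kato2004.nonempty_iwasawaH1Data) (h12 : Kato2004.thm12_4)
    (hns : Kato2004.exists_multDivisibilityInputs_nonsplit)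
    (hsp : Kato2004.exists_multDivisibilityInputs_split)
    (h15 : thm15_isTorsion_multiplicative_rat)
    (h18 : Wuthrich2014.corollary18_padicLFunction_mem_iwasawaAlgebra_multiplicative)
    (hfine : Kato2004.exists_multDivisibilityInputs_fine)
    (W : WeierstrassCurve ℚ) [W.IsElliptic] [W.IsGloballyMinimal] (p : ℕ) [Fact p.Prime]
    (hp : p ≠ 2) (hmult : Mult W p) (hirr : Irr W p) (hA : ConjAAt W p) :
    MultDivisibilityAt W p := by
  have hK : KatoMultiplicativeDivisibilityRat W p :=
    Summit.BirchSwinnertonDyer.BirchSwinnertonDyer.Theorems.MultKatoRat.katoMultiplicativeDivisibilityRat_of_facts_odd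
      W p hp hne h12 hns hsp h15
  haveI : ContinuousSMul ℤ_[p] (W.tateModule p) := TateModule.continuousSMul_padicInt
  haveI : Module.Free ℤ_[p] (W.tateModule p) := W.module_free_tateModule_holds p
  haveI : Module.Finite ℤ_[p] (W.tateModule p) := W.module_finite_tateModule_holds p
  intro κ γ N _ f hκ hγ hγ' hf D ϖ hϖ0 hϖ
  haveI : Module.Finite (IwasawaAlgebra p) D.X :=
    WeierstrassCurve.SelmerDualData.module_finite_of_isCyclotomic W κ hκ D hγ
  obtain ⟨hX, hnsK, hsK⟩ := hK κ γ hκ hγ hγ' hmult f hf D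
  obtain ⟨hint_ns, hint_s⟩ := h18 W p hp hmult hf ϖ hϖ
  obtain ⟨I⟩ := hne W p κ γ hκ hγ
  obtain ⟨Y⟩ := W.nonempty_fineSelmerDualData κ hγ
  -- statement (A) ⟹ `μ(X₀) = 0` for Kato's fine datum
  have hμY : Module.Finite (IwasawaAlgebra p) Y.X → Module.IsTorsion (IwasawaAlgebra p) Y.X →
      muInvariant p Y.X = 0 := fun hYf hYt ↦ hA.fineMuZeroAt κ γ hκ hγ hγ' Y hYf hYt
  -- the non-zero constants absorbing `ϖ`
  have hnum : ((ϖ.num : ℤ) : ℤ_[p]) ≠ 0 := by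
    exact_mod_cast Rat.num_ne_zero.mpr hϖ0
  have hden : ∀ n : ℕ, ((ϖ.den : ℕ) : ℤ_[p]) * (p : ℤ_[p]) ^ n ≠ 0 := fun n ↦
    mul_ne_zero (by exact_mod_cast ϖ.den_nz) (pow_ne_zero n (by exact_mod_cast (Fact.out : p.Prime).ne_zero))
  refine ⟨hX, fun hn L hL ↦ ?_, fun hsplit L hL ↦ ?_⟩
  · -- NON-SPLIT: `a = -1`
    obtain ⟨n, g, hg, hι⟩ := hnsK hn L hL
    obtain ⟨G, hG⟩ := hint_ns hn L hL
    obtain ⟨K, π, hloc0, hπs, hπ, -, himg⟩ :=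
      hfine W p f κ γ hp hmult hκ hγ hγ' hf (-1) L (fun hs ↦ absurd hs hn) (fun _ ↦ rfl) hL I D Y
    refine ⟨G, ?_, hG⟩
    exact MultFineMu.mem_charIdeal_of_multFine_of_fineMuZero K hloc0 π hπs hπ hX hμY
      (fun 𝔭 h1 ↦ by
        obtain ⟨s, hs, hsG, -⟩ := himg hirr G ϖ hϖ hG 𝔭 h1
        exact ⟨s, hs, hsG⟩)
      (one_mul G).symm (fun h ↦ (IwasawaAlgebra.isPrime_augIdealP_holds p).ne_top ((Ideal.eq_top_iff_one _).mpr h)) hg hnum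
      (hden n) (MultFineMu.C_num_mul_eq_C_den_mul hι hG)
  · -- SPLIT: `a = 1`, the trivial zero divided out
    have hL1 : IsMultPAdicLFunctionOf f p 1 L := (isMultPAdicLFunctionOf_one_iff L).mpr hL
    obtain ⟨n, g, hg, hι⟩ := hsK hsplit L hL
    obtain ⟨G, hG⟩ := hint_s hsplit L hL
    obtain ⟨K, π, hloc0, hπs, hπ, -, himg⟩ :=
      hfine W p f κ γ hp hmult hκ hγ hγ' hf 1 L (fun _ ↦ rfl) (fun hns' ↦ absurd hsplit hns') hL1 I D Y
    -- `C(num)·(T·g) = C(den·pⁿ)·G`, hence `T ∣ G`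
    have hrel := MultFineMu.C_num_mul_eq_C_den_mul hι hG
    have hXdvd : (PowerSeries.X : IwasawaAlgebra p) ∣
        PowerSeries.C (((ϖ.den : ℕ) : ℤ_[p]) * (p : ℤ_[p]) ^ n) * G :=
      ⟨PowerSeries.C ((ϖ.num : ℤ) : ℤ_[p]) * g, by rw [← hrel]; ring⟩
    have hXG : (PowerSeries.X : IwasawaAlgebra p) ∣ G := by
      refine (PowerSeries.X_prime.dvd_or_dvd hXdvd).resolve_left fun h ↦ hden n ?_
      rwa [PowerSeries.X_dvd_iff, PowerSeries.constantCoeff_C] at h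
    obtain ⟨G', rfl⟩ := hXG
    have hrel' : PowerSeries.C ((ϖ.num : ℤ) : ℤ_[p]) * g =
        PowerSeries.C (((ϖ.den : ℕ) : ℤ_[p]) * (p : ℤ_[p]) ^ n) * G' :=
      mul_left_cancel₀ (PowerSeries.X_ne_zero (R := ℤ_[p])) (by rw [← mul_assoc, ← mul_assoc,
        mul_comm PowerSeries.X, mul_comm PowerSeries.X, mul_assoc, hrel, mul_assoc])
    refine ⟨G', ?_, hG⟩
    exact MultFineMu.mem_charIdeal_of_multFine_of_fineMuZero K hloc0 π hπs hπ hX hμY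
      (fun 𝔭 h1 ↦ by
        obtain ⟨s, hs, hsG, -⟩ := himg hirr (PowerSeries.X * G') ϖ hϖ hG 𝔭 h1
        exact ⟨s, hs, hsG⟩)
      rfl ZetaImage.X_notMem_augIdealP hg hnum (hden n) hrel'

end Summit.BirchSwinnertonDyer.Rank1Residual.X11b

/-! ### §5 The registered stub of line «finemu3», verbatim signature -/

namespace Summit.BirchSwinnertonDyer.BirchSwinnertonDyer.Theorems

open Summit.BirchSwinnertonDyer.Rank1Residual.X11b

/-- **Stub `stub_multDivisibilityAt_of_conjA` of `Cruxes/UpperNonSurjThree/Lines/finemu3.lean` (item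
stmt-BirchSwinnertonDyer-20613), signature VERBATIM**: the seven named facts imply
`∀ W p, p ≠ 2 → Mult W p → Irr W p → ConjAAt W p → MultDivisibilityAt W p`.  One-line wrapper of
`X11b.multDivisibilityAt_of_katoFacts_of_conjAAt`; CONDITIONAL on the displayed facts and on (A); closes nothing.
[cite: Kato2004Asterisque, Thm. 12.5 (3) (p. 222), (14.9.3) (p. 240), §17.13 (pp. 279–280)]
[cite: Wuthrich2014, Lemma 14 (p. 396), Prop. 15 (p. 397), Cor. 18 (p. 398)] [cite: CoatesSujatha2005, §3 statement (A)] -/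
theorem stub_multDivisibilityAt_of_conjA :
    Kato2004.nonempty_iwasawaH1Data → Kato2004.thm12_4 →
    Kato2004.exists_multDivisibilityInputs_nonsplit → Kato2004.exists_multDivisibilityInputs_split →
    thm15_isTorsion_multiplicative_rat →
    Wuthrich2014.corollary18_padicLFunction_mem_iwasawaAlgebra_multiplicative →
    Kato2004.exists_multDivisibilityInputs_fine →
    ∀ (W : WeierstrassCurve ℚ) [W.IsElliptic] [W.IsGloballyMinimal] (p : ℕ) [Fact p.Prime],
      p ≠ 2 → Mult W p → Irr W p → ConjAAt W p → MultDivisibilityAt W p :=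
  fun hne h12 hns hsp h15 h18 hfine W _ _ p _ hp hmult hirr hA ↦
    multDivisibilityAt_of_katoFacts_of_conjAAt hne h12 hns hsp h15 h18 hfine W p hp hmult hirr hA

end Summit.BirchSwinnertonDyer.BirchSwinnertonDyer.Theorems

end
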